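import Mathlib
import Literature.Analysis.FluidPDE.NormalisedPressureDischarge
import Summits.NavierStokesRegularity.NavierStokesRegularity.Theses.PlaneEnergyCeiling
import Summits.NavierStokesRegularity.NavierStokesRegularity.Theorems.PlaneEnergyCeilingPlanarEnergyAPrioriFluxVariation
import Summits.NavierStokesRegularity.NavierStokesRegularity.Theorems.PlaneEnergyCeilingPlanarEnergyAPrioriSlabLawMild
import Summits.NavierStokesRegularity.NavierStokesRegularity.Theorems.PlaneEnergyCeilingPlanarEnergyAPrioriDecayPersistence
import Summits.NavierStokesRegularity.NavierStokesRegularity.Theorems.PlaneEnergyCeilingPlanarEnergyAPrioriClosedSlab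
import Summits.NavierStokesRegularity.NavierStokesRegularity.Theorems.PlaneEnergyCeilingPlanarEnergyAPrioriInitialCeiling

/-!
# Route PlaneEnergyCeiling · crux `PlanarEnergyAPriori` — THE DYNAMIC PLANAR CEILING (F2)

Helper file for the crux item stmt-NavierStokesRegularity-16855 (`PlanarEnergyAPriori`), landed
`--supports` that item: the Volterra closure of the line `birth` (strategist census gen 1, A-S6 (F2)),
UNCONDITIONAL now that all its inputs are theorems of the tree — the mild slab law
(`stub_slabLawMild`), decay persistence (`stub_decayPersistence`), Tao's pressure normalisation
(`pressure_sub_pressurePotential_eq`), the flux variation bound (`fluxVariationBound`) and the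
closed-slab ceiling (`planarCeiling_closedSlab`).

**`dynamicPlanarCeiling`.** There is a universal `C ≥ 0` such that along every classical solution
`(u,p)` of unforced Navier–Stokes on `ℝ³ × [0,T)` that is Leray–Hopf from a rapidly decaying datum,
for every `t < T`, direction `R` and offset `c`,

  `E(u(t);R,c) ≤ 2·P(0) + (C/ν) · W(t)²`,   `W(t) = sup_{t' ≤ t} ∫₀^{t'} (t'−s)^{-1/2} Z(s) ds`,  `Z(s) = ∫ ‖Du(s)‖²`,

`P(0) = sup_{R,c} E(u(0);R,c)` the initial planar ceiling. Proof: for `0 < t' ≤ t` the mild slab law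
on `[0,t']` gives `E(t';R,c) ≤ P_R(0) + 2∫₀^{t'} (πν(t'−s))^{-1/2} osc_c F(s;R,·) ds`; at each
`s ∈ (0,t')` the flux variation bound (the slice `u(s)` is `C^∞`, divergence free, decays to order
`(3,2)` with its pressure, and `p(s) = p̃[u(s)] + c(s)` by Tao's normalisation) gives
`osc_c F ≤ K_F √(P_R(s)) Z(s) ≤ K_F √Q Z(s)`, `Q = sup_{[0,t]} P < ∞` (closed-slab ceiling); hence
`Q ≤ P(0) + 2K_F(πν)^{-1/2} √Q · W(t)` and the quadratic inequality closes to
`Q ≤ 2P(0) + 4K_F² W(t)²/(πν)`.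

* `planarEnergyAPriori_of_halfPotentialBound` — the crux BY NAME from a bound on the enstrophy
  half-potential `W` along every frame solution (the census's `HalfPotentialEnstrophyBound`; it is
  NoBlowup in other clothes by Leray's enstrophy rate, census `HalfPotentialDivergesAtBlowup`);
(The crux BY NAME from the one open stub `stub_fluxConvergenceBudget` of the line `birth` is the
landed `planarEnergyAPriori_of_fluxConvergenceBudget` of `…PlanarEnergyAPrioriOfBudget.lean`.)
-/

noncomputable section

-- single-conjunct summit: `Summit.<Summit>.<Problem>` repeats the name by the D-0017 layout
set_option linter.dupNamespace false

namespace Summit.NavierStokesRegularity.NavierStokesRegularity.Theorems.PlanarEnergyAPriori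

open MeasureTheory Set Filter Topology Function WithLp
open scoped ENNReal NNReal RealInnerProductSpace
open Literature.Analysis.FluidPDE
open Summit.NavierStokesRegularity.NavierStokesRegularity.Theorems.PlaneEnergyCeilingSlabEnergyIdentity
open Summit.NavierStokesRegularity.NavierStokesRegularity.Theorems.PlanarEnergyAPriori.SlabLaw

/-! ### The quadratic (Volterra) closure -/

/-- **Quadratic closure.** In `ℝ≥0∞`: if `Q < ∞` and `Q ≤ A + √Q · D` then `Q ≤ 2A + D²`
(`√Q D ≤ (Q + D²)/2`). -/
theorem le_two_mul_add_sq_of_le_add_sqrt_mul {Q A D : ℝ≥0∞} (hQ : Q ≠ ⊤)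
    (h : Q ≤ A + Q ^ (1 / 2 : ℝ) * D) : Q ≤ 2 * A + D ^ 2 := by
  by_cases hA : A = ⊤
  · rw [hA]; simp
  by_cases hD : D = ⊤
  · rw [hD]; simp
  -- pass to real numbers
  have hq0 : 0 ≤ Q.toReal := ENNReal.toReal_nonneg
  have ha0 : 0 ≤ A.toReal := ENNReal.toReal_nonneg
  have hd0 : 0 ≤ D.toReal := ENNReal.toReal_nonneg
  have hfin1 : Q ^ (1 / 2 : ℝ) * D ≠ ⊤ := ENNReal.mul_ne_top (ENNReal.rpow_ne_top_of_nonneg (by norm_num) hQ) hD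
  have hfin : A + Q ^ (1 / 2 : ℝ) * D ≠ ⊤ := ENNReal.add_ne_top.2 ⟨hA, hfin1⟩
  have hreal : Q.toReal ≤ A.toReal + Real.sqrt Q.toReal * D.toReal := by
    have h' := ENNReal.toReal_mono hfin h
    rw [ENNReal.toReal_add hA hfin1, ENNReal.toReal_mul, ← ENNReal.toReal_rpow] at h'
    rw [Real.sqrt_eq_rpow]
    exact h'
  have hs : Real.sqrt Q.toReal ^ 2 = Q.toReal := Real.sq_sqrt hq0
  have hkey : Q.toReal ≤ 2 * A.toReal + D.toReal ^ 2 := by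
    nlinarith [sq_nonneg (Real.sqrt Q.toReal - D.toReal), Real.sqrt_nonneg Q.toReal]
  rw [← ENNReal.ofReal_toReal hQ, ← ENNReal.ofReal_toReal hA, ← ENNReal.ofReal_toReal hD, ← ENNReal.ofReal_ofNat,
    ← ENNReal.ofReal_mul (by norm_num), ← ENNReal.ofReal_pow hd0, ← ENNReal.ofReal_add (by positivity) (by positivity)]
  exact ENNReal.ofReal_le_ofReal hkey

/-! ### The flux variation bound along the solution -/

variable {ν T : ℝ} {u : ℝ → EuclideanSpace ℝ (Fin 3) → EuclideanSpace ℝ (Fin 3)} {p : ℝ → EuclideanSpace ℝ (Fin 3) → ℝ}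

/-- **The oscillation of the Bernoulli flux along a classical Leray–Hopf solution from a rapidly
decaying datum**: for `0 < s < T`, every direction `R` and offsets `a, b`,
`‖F(s;R,a) − F(s;R,b)‖ ≤ K_F √(sup_c E(u(s);R,c)) · ∫‖Du(s)‖²`, with the universal constant of
`fluxVariationBound`. (The slice is `C^∞` and divergence free; decay persistence on `[0,(s+T)/2]`
supplies the order-(3,2) decay; Tao's normalisation on that closed slab gives
`p(s) = p̃[u(s)] + c(s)`.) -/
theorem osc_bernoulliFlux_le_alongSolution {K_F : ℝ≥0∞}
    (hK : ∀ (w : EuclideanSpace ℝ (Fin 3) → EuclideanSpace ℝ (Fin 3)) (q : EuclideanSpace ℝ (Fin 3) → ℝ) (C π₀ : ℝ),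
      ContDiff ℝ 4 w → ContDiff ℝ 1 q → VectorCalculus.IsDivFree w →
      (∀ x, ‖w x‖ ≤ C * (1 + ‖x‖) ^ (-(3 : ℝ))) → (∀ x, ‖fderiv ℝ w x‖ ≤ C * (1 + ‖x‖) ^ (-(3 : ℝ))) →
      (∀ x, ‖q x - π₀‖ ≤ C * (1 + ‖x‖) ^ (-(2 : ℝ))) → (∀ x, ‖fderiv ℝ q x‖ ≤ C * (1 + ‖x‖) ^ (-(2 : ℝ))) →
      (∃ c₀ : ℝ, ∀ x, q x = normalisedPressure w x + c₀) →
      ∀ (R : EuclideanSpace ℝ (Fin 3) ≃ₗᵢ[ℝ] EuclideanSpace ℝ (Fin 3)) (a b : ℝ),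
        ‖(∫ y : EuclideanSpace ℝ (Fin 2), (‖w (R (toLp 2 ![y 0, y 1, a]))‖ ^ 2 / 2 + q (R (toLp 2 ![y 0, y 1, a]))) *
            ⟪w (R (toLp 2 ![y 0, y 1, a])), R (EuclideanSpace.single 2 1)⟫) -
          ∫ y : EuclideanSpace ℝ (Fin 2), (‖w (R (toLp 2 ![y 0, y 1, b]))‖ ^ 2 / 2 + q (R (toLp 2 ![y 0, y 1, b]))) *
            ⟪w (R (toLp 2 ![y 0, y 1, b])), R (EuclideanSpace.single 2 1)⟫‖ₑ ≤
          K_F * (⨆ c : ℝ, ∫⁻ y : EuclideanSpace ℝ (Fin 2), ‖w (R (toLp 2 ![y 0, y 1, c]))‖ₑ ^ 2) ^ (1 / 2 : ℝ) *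
            ∫⁻ x, ‖fderiv ℝ w x‖ₑ ^ 2)
    (hν : 0 < ν) (hT : 0 < T) (hcl : IsClassicalNSSolutionOn (Ico 0 T) ν 0 u p)
    (hLH : IsLerayHopfOn T ν 0 (u 0) u) (hdec : HasRapidSpatialDecay (u 0)) {s : ℝ} (hs : s ∈ Ioo 0 T)
    (R : EuclideanSpace ℝ (Fin 3) ≃ₗᵢ[ℝ] EuclideanSpace ℝ (Fin 3)) (a b : ℝ) :
    ‖(∫ y : EuclideanSpace ℝ (Fin 2), (‖u s (R (toLp 2 ![y 0, y 1, a]))‖ ^ 2 / 2 + p s (R (toLp 2 ![y 0, y 1, a]))) *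
        ⟪u s (R (toLp 2 ![y 0, y 1, a])), R (EuclideanSpace.single 2 1)⟫) -
      ∫ y : EuclideanSpace ℝ (Fin 2), (‖u s (R (toLp 2 ![y 0, y 1, b]))‖ ^ 2 / 2 + p s (R (toLp 2 ![y 0, y 1, b]))) *
        ⟪u s (R (toLp 2 ![y 0, y 1, b])), R (EuclideanSpace.single 2 1)⟫‖ₑ ≤
      K_F * (⨆ c : ℝ, ∫⁻ y : EuclideanSpace ℝ (Fin 2), ‖u s (R (toLp 2 ![y 0, y 1, c]))‖ₑ ^ 2) ^ (1 / 2 : ℝ) *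
        ∫⁻ x, ‖fderiv ℝ (u s) x‖ₑ ^ 2 := by
  -- an intermediate closed slab `[0, t₁]` with `s < t₁ < T`
  set t₁ : ℝ := (s + T) / 2 with ht₁
  have hst₁ : s < t₁ := by rw [ht₁]; linarith [hs.2]
  have ht₁T : t₁ < T := by rw [ht₁]; linarith [hs.2]
  have ht₁0 : 0 < t₁ := hs.1.trans hst₁
  have hcl₁ : IsClassicalNSSolutionOn (Icc 0 t₁) ν 0 u p :=
    hcl.mono (Icc_subset_Ico_right ht₁T) (uniqueDiffOn_Icc ht₁0)
  -- decay persistence on `[0, t₁]`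
  obtain ⟨C₀, π₀, hD⟩ := stub_decayPersistence ν T hν hT u p hcl hLH hdec t₁ ⟨ht₁0.le, ht₁T⟩
  have hsI : s ∈ Icc 0 t₁ := ⟨hs.1.le, hst₁.le⟩
  have h0 : ∀ x, ‖u s x‖ ≤ C₀ * (1 + ‖x‖) ^ (-(3 : ℝ)) := fun x => le_mul_rpow_neg_three_of_mul_le (hD s hsI x).1
  have h1 : ∀ x, ‖fderiv ℝ (u s) x‖ ≤ C₀ * (1 + ‖x‖) ^ (-(3 : ℝ)) := fun x =>
    le_mul_rpow_neg_three_of_mul_le (hD s hsI x).2.1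
  have k0 : ∀ x, ‖p s x - π₀ s‖ ≤ C₀ * (1 + ‖x‖) ^ (-(2 : ℝ)) := fun x => by
    rw [Real.norm_eq_abs]; exact le_mul_rpow_neg_two_of_mul_le (hD s hsI x).2.2.2.1
  have k1 : ∀ x, ‖fderiv ℝ (p s) x‖ ≤ C₀ * (1 + ‖x‖) ^ (-(2 : ℝ)) := fun x => by
    rw [norm_fderiv_eq_norm_gradient]; exact le_mul_rpow_neg_two_of_mul_le (hD s hsI x).2.2.2.2
  -- the slice is smooth and divergence free
  have hsu : ContDiff ℝ 4 (u s) := contDiff_infty.1 (hcl₁.contDiff_velocity hsI) 4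
  have hsp : ContDiff ℝ 1 (p s) := contDiff_infty.1 (hcl₁.contDiff_pressure hsI) 1
  have hdiv : VectorCalculus.IsDivFree (u s) := hcl₁.divFree s hsI
  -- Tao's normalisation: `p(s) = p̃[u(s)] + c(s)`
  have hint : ∀ τ ∈ Icc 0 t₁, Integrable fun y => ‖u τ y‖ ^ 2 := fun τ hτ =>
    integrable_norm_sq (hcl₁.contDiff_velocity hτ).continuous fun x => le_mul_rpow_neg_three_of_mul_le (hD τ hτ x).1
  have hE : ∀ τ ∈ Icc 0 t₁, ∫ y, ‖u τ y‖ ^ 2 ≤ 2 * VectorCalculus.kineticEnergy (u 0) := fun τ hτ =>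
    integral_norm_sq_le_of_isLerayHopfOn hLH hν.le ⟨hτ.1, hτ.2.trans ht₁T.le⟩
  have hE0 : 0 ≤ 2 * VectorCalculus.kineticEnergy (u 0) := mul_nonneg zero_le_two (kineticEnergy_nonneg _)
  have hid : ∃ c₀ : ℝ, ∀ x, p s x = normalisedPressure (u s) x + c₀ := by
    refine ⟨p s 0 - pressurePotential (u s) 0, fun x => ?_⟩
    have hx := pressure_sub_pressurePotential_eq hν.le hcl₁ hE0 hint hE ⟨hs.1, hst₁⟩ x
    rw [normalisedPressure_eq_pressurePotential' (hsu.of_le (by norm_num)) (hint s hsI)]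
    linarith
  exact hK (u s) (p s) C₀ (π₀ s) hsu hsp hdiv h0 h1 k0 k1 hid R a b

/-! ### The dynamic planar ceiling -/

/-- Kernel factorisation: `(√(ab))⁻¹ = (√a)⁻¹ (√b)⁻¹` in `ℝ≥0∞` for `a ≥ 0`. -/
theorem ofReal_inv_sqrt_mul {a b : ℝ} (ha : 0 ≤ a) :
    ENNReal.ofReal ((Real.sqrt (a * b))⁻¹) =
      ENNReal.ofReal ((Real.sqrt a)⁻¹) * ENNReal.ofReal ((Real.sqrt b)⁻¹) := by
  rw [Real.sqrt_mul ha, mul_inv, ENNReal.ofReal_mul (inv_nonneg.2 (Real.sqrt_nonneg _))]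

/-- **THE DYNAMIC PLANAR CEILING** (section form, with the flux-variation constant `K_F` as a
hypothesis). Along a classical Leray–Hopf solution from a rapidly decaying datum on `[0,T)`, for
`t < T`, every direction `R` and offset `c`:
`E(u(t);R,c) ≤ 2·sup_{R',c'} E(u(0);R',c') + (4K_F²/(πν)) · W(t)²`,
`W(t) = sup_{t'∈[0,t]} ∫_{(0,t')} (t'−s)^{-1/2} ∫‖Du(s)‖² ds`. [strategist census gen 1, A-S6 (F2)] -/
theorem dynamicPlanarCeiling_of_fluxVariation {K_F : ℝ≥0∞} (hKt : K_F ≠ ⊤)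
    (hK : ∀ (w : EuclideanSpace ℝ (Fin 3) → EuclideanSpace ℝ (Fin 3)) (q : EuclideanSpace ℝ (Fin 3) → ℝ) (C π₀ : ℝ),
      ContDiff ℝ 4 w → ContDiff ℝ 1 q → VectorCalculus.IsDivFree w →
      (∀ x, ‖w x‖ ≤ C * (1 + ‖x‖) ^ (-(3 : ℝ))) → (∀ x, ‖fderiv ℝ w x‖ ≤ C * (1 + ‖x‖) ^ (-(3 : ℝ))) →
      (∀ x, ‖q x - π₀‖ ≤ C * (1 + ‖x‖) ^ (-(2 : ℝ))) → (∀ x, ‖fderiv ℝ q x‖ ≤ C * (1 + ‖x‖) ^ (-(2 : ℝ))) →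
      (∃ c₀ : ℝ, ∀ x, q x = normalisedPressure w x + c₀) →
      ∀ (R : EuclideanSpace ℝ (Fin 3) ≃ₗᵢ[ℝ] EuclideanSpace ℝ (Fin 3)) (a b : ℝ),
        ‖(∫ y : EuclideanSpace ℝ (Fin 2), (‖w (R (toLp 2 ![y 0, y 1, a]))‖ ^ 2 / 2 + q (R (toLp 2 ![y 0, y 1, a]))) *
            ⟪w (R (toLp 2 ![y 0, y 1, a])), R (EuclideanSpace.single 2 1)⟫) -
          ∫ y : EuclideanSpace ℝ (Fin 2), (‖w (R (toLp 2 ![y 0, y 1, b]))‖ ^ 2 / 2 + q (R (toLp 2 ![y 0, y 1, b]))) *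
            ⟪w (R (toLp 2 ![y 0, y 1, b])), R (EuclideanSpace.single 2 1)⟫‖ₑ ≤
          K_F * (⨆ c : ℝ, ∫⁻ y : EuclideanSpace ℝ (Fin 2), ‖w (R (toLp 2 ![y 0, y 1, c]))‖ₑ ^ 2) ^ (1 / 2 : ℝ) *
            ∫⁻ x, ‖fderiv ℝ w x‖ₑ ^ 2)
    (hν : 0 < ν) (hT : 0 < T) (hcl : IsClassicalNSSolutionOn (Ico 0 T) ν 0 u p)
    (hLH : IsLerayHopfOn T ν 0 (u 0) u) (hdec : HasRapidSpatialDecay (u 0)) {t : ℝ} (ht : t ∈ Ico 0 T)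
    (R : EuclideanSpace ℝ (Fin 3) ≃ₗᵢ[ℝ] EuclideanSpace ℝ (Fin 3)) (c : ℝ) :
    ∫⁻ y : EuclideanSpace ℝ (Fin 2), ‖u t (R (toLp 2 ![y 0, y 1, c]))‖ₑ ^ 2 ≤
      2 * (⨆ (R' : EuclideanSpace ℝ (Fin 3) ≃ₗᵢ[ℝ] EuclideanSpace ℝ (Fin 3)) (c' : ℝ),
            ∫⁻ y : EuclideanSpace ℝ (Fin 2), ‖u 0 (R' (toLp 2 ![y 0, y 1, c']))‖ₑ ^ 2) +
        (4 * K_F ^ 2 * ENNReal.ofReal ((Real.pi * ν)⁻¹)) *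
          (⨆ t' ∈ Icc 0 t, ∫⁻ s in Ioo 0 t', ENNReal.ofReal ((Real.sqrt (t' - s))⁻¹) *
            ∫⁻ x, ‖fderiv ℝ (u s) x‖ₑ ^ 2) ^ 2 := by
  -- notation
  set P₀ : ℝ≥0∞ := ⨆ (R' : EuclideanSpace ℝ (Fin 3) ≃ₗᵢ[ℝ] EuclideanSpace ℝ (Fin 3)) (c' : ℝ),
    ∫⁻ y : EuclideanSpace ℝ (Fin 2), ‖u 0 (R' (toLp 2 ![y 0, y 1, c']))‖ₑ ^ 2 with hP₀
  set W : ℝ≥0∞ := ⨆ t' ∈ Icc 0 t, ∫⁻ s in Ioo 0 t', ENNReal.ofReal ((Real.sqrt (t' - s))⁻¹) *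
    ∫⁻ x, ‖fderiv ℝ (u s) x‖ₑ ^ 2 with hW
  have hE0 : ∀ (R' : EuclideanSpace ℝ (Fin 3) ≃ₗᵢ[ℝ] EuclideanSpace ℝ (Fin 3)) (c' : ℝ),
      ∫⁻ y : EuclideanSpace ℝ (Fin 2), ‖u 0 (R' (toLp 2 ![y 0, y 1, c']))‖ₑ ^ 2 ≤ P₀ := fun R' c' =>
    le_iSup₂_of_le (f := fun (R' : EuclideanSpace ℝ (Fin 3) ≃ₗᵢ[ℝ] EuclideanSpace ℝ (Fin 3)) (c' : ℝ) =>
      ∫⁻ y : EuclideanSpace ℝ (Fin 2), ‖u 0 (R' (toLp 2 ![y 0, y 1, c']))‖ₑ ^ 2) R' c' le_rfl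
  rcases eq_or_lt_of_le ht.1 with h0t | htpos
  · -- the initial slice
    subst h0t
    calc _ ≤ P₀ := hE0 R c
      _ ≤ 2 * P₀ := le_mul_of_one_le_left (by simp) (by norm_num)
      _ ≤ _ := le_self_add
  -- the running planar ceiling `Q = sup_{[0,t]} P` is finite (closed-slab ceiling)
  set Q : ℝ≥0∞ := ⨆ t' ∈ Icc 0 t, ⨆ (R' : EuclideanSpace ℝ (Fin 3) ≃ₗᵢ[ℝ] EuclideanSpace ℝ (Fin 3)), ⨆ c' : ℝ,
    ∫⁻ y : EuclideanSpace ℝ (Fin 2), ‖u t' (R' (toLp 2 ![y 0, y 1, c']))‖ₑ ^ 2 with hQ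
  have hEQ : ∀ t' ∈ Icc 0 t, ∀ (R' : EuclideanSpace ℝ (Fin 3) ≃ₗᵢ[ℝ] EuclideanSpace ℝ (Fin 3)) (c' : ℝ),
      ∫⁻ y : EuclideanSpace ℝ (Fin 2), ‖u t' (R' (toLp 2 ![y 0, y 1, c']))‖ₑ ^ 2 ≤ Q := fun t' ht' R' c' =>
    le_iSup₂_of_le (f := fun (t' : ℝ) (_ : t' ∈ Icc 0 t) => ⨆ (R' : EuclideanSpace ℝ (Fin 3) ≃ₗᵢ[ℝ] EuclideanSpace ℝ (Fin 3)), ⨆ c' : ℝ,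
      ∫⁻ y : EuclideanSpace ℝ (Fin 2), ‖u t' (R' (toLp 2 ![y 0, y 1, c']))‖ₑ ^ 2) t' ht'
      (le_iSup_of_le (f := fun R' : EuclideanSpace ℝ (Fin 3) ≃ₗᵢ[ℝ] EuclideanSpace ℝ (Fin 3) => ⨆ c' : ℝ,
        ∫⁻ y : EuclideanSpace ℝ (Fin 2), ‖u t' (R' (toLp 2 ![y 0, y 1, c']))‖ₑ ^ 2) R'
        (le_iSup (fun c' : ℝ => ∫⁻ y : EuclideanSpace ℝ (Fin 2), ‖u t' (R' (toLp 2 ![y 0, y 1, c']))‖ₑ ^ 2) c'))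
  obtain ⟨M, hM⟩ := planarCeiling_closedSlab hν hcl hLH hdec (T₁ := t) ⟨htpos, ht.2⟩
  have hQM : Q ≤ ENNReal.ofReal M :=
    iSup₂_le fun t' ht' => iSup_le fun R' => iSup_le fun c' => hM t' ht' R' c'
  have hQt : Q ≠ ⊤ := ne_top_of_le_ne_top ENNReal.ofReal_ne_top hQM
  -- the coefficient `B = 2 K_F (πν)^{-1/2}`
  set B : ℝ≥0∞ := 2 * K_F * ENNReal.ofReal ((Real.sqrt (Real.pi * ν))⁻¹) with hB
  have hconst : K_F * Q ^ (1 / 2 : ℝ) * ENNReal.ofReal ((Real.sqrt (Real.pi * ν))⁻¹) ≠ ⊤ :=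
    ENNReal.mul_ne_top (ENNReal.mul_ne_top hKt (ENNReal.rpow_ne_top_of_nonneg (by norm_num) hQt))
      ENNReal.ofReal_ne_top
  -- the main estimate on `[0, t]`
  have hmain : ∀ t' ∈ Icc 0 t, ∀ (R' : EuclideanSpace ℝ (Fin 3) ≃ₗᵢ[ℝ] EuclideanSpace ℝ (Fin 3)) (c' : ℝ),
      ∫⁻ y : EuclideanSpace ℝ (Fin 2), ‖u t' (R' (toLp 2 ![y 0, y 1, c']))‖ₑ ^ 2 ≤ P₀ + Q ^ (1 / 2 : ℝ) * (B * W) := by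
    intro t' ht' R' c'
    rcases eq_or_lt_of_le ht'.1 with h0 | ht'pos
    · subst h0; exact (hE0 R' c').trans le_self_add
    have ht'T : t' < T := lt_of_le_of_lt ht'.2 ht.2
    have hcl' : IsClassicalNSSolutionOn (Icc 0 t') ν 0 u p :=
      hcl.mono (Icc_subset_Ico_right ht'T) (uniqueDiffOn_Icc ht'pos)
    have hdecay := stub_decayPersistence ν T hν hT u p hcl hLH hdec t' ⟨ht'.1, ht'T⟩
    have hslab := stub_slabLawMild ν t' hν ht'pos u p hcl' hdecay R' c'
    refine hslab.trans ?_
    have hP0 : (⨆ c'' : ℝ, ∫⁻ y : EuclideanSpace ℝ (Fin 2), ‖u 0 (R' (toLp 2 ![y 0, y 1, c'']))‖ₑ ^ 2) ≤ P₀ :=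
      iSup_le fun c'' => hE0 R' c''
    -- the flux-convergence integral on `(0, t')`
    have hint : (∫⁻ s in Ioo 0 t', ENNReal.ofReal ((Real.sqrt (Real.pi * ν * (t' - s)))⁻¹) *
        ⨆ (a : ℝ) (b : ℝ), ‖(∫ y : EuclideanSpace ℝ (Fin 2), (‖u s (R' (toLp 2 ![y 0, y 1, a]))‖ ^ 2 / 2 +
            p s (R' (toLp 2 ![y 0, y 1, a]))) * ⟪u s (R' (toLp 2 ![y 0, y 1, a])), R' (EuclideanSpace.single 2 1)⟫) -
          ∫ y : EuclideanSpace ℝ (Fin 2), (‖u s (R' (toLp 2 ![y 0, y 1, b]))‖ ^ 2 / 2 +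
            p s (R' (toLp 2 ![y 0, y 1, b]))) * ⟪u s (R' (toLp 2 ![y 0, y 1, b])), R' (EuclideanSpace.single 2 1)⟫‖ₑ) ≤
        (K_F * Q ^ (1 / 2 : ℝ) * ENNReal.ofReal ((Real.sqrt (Real.pi * ν))⁻¹)) *
          ∫⁻ s in Ioo 0 t', ENNReal.ofReal ((Real.sqrt (t' - s))⁻¹) * ∫⁻ x, ‖fderiv ℝ (u s) x‖ₑ ^ 2 := by
      rw [← lintegral_const_mul' _ _ hconst]
      refine setLIntegral_mono' measurableSet_Ioo fun s hs => ?_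
      have hsT : s ∈ Ioo 0 T := ⟨hs.1, hs.2.trans ht'T⟩
      have hPs : (⨆ c'' : ℝ, ∫⁻ y : EuclideanSpace ℝ (Fin 2), ‖u s (R' (toLp 2 ![y 0, y 1, c'']))‖ₑ ^ 2) ≤ Q :=
        iSup_le fun c'' => hEQ s ⟨hs.1.le, hs.2.le.trans ht'.2⟩ R' c''
      have hosc : (⨆ (a : ℝ) (b : ℝ), ‖(∫ y : EuclideanSpace ℝ (Fin 2), (‖u s (R' (toLp 2 ![y 0, y 1, a]))‖ ^ 2 / 2 +
            p s (R' (toLp 2 ![y 0, y 1, a]))) * ⟪u s (R' (toLp 2 ![y 0, y 1, a])), R' (EuclideanSpace.single 2 1)⟫) -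
          ∫ y : EuclideanSpace ℝ (Fin 2), (‖u s (R' (toLp 2 ![y 0, y 1, b]))‖ ^ 2 / 2 +
            p s (R' (toLp 2 ![y 0, y 1, b]))) * ⟪u s (R' (toLp 2 ![y 0, y 1, b])), R' (EuclideanSpace.single 2 1)⟫‖ₑ) ≤
          K_F * Q ^ (1 / 2 : ℝ) * ∫⁻ x, ‖fderiv ℝ (u s) x‖ₑ ^ 2 := by
        refine iSup₂_le fun a b => ?_
        refine (osc_bernoulliFlux_le_alongSolution hK hν hT hcl hLH hdec hsT R' a b).trans ?_
        gcongr
      rw [ofReal_inv_sqrt_mul (by positivity : 0 ≤ Real.pi * ν)]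
      calc ENNReal.ofReal ((Real.sqrt (Real.pi * ν))⁻¹) * ENNReal.ofReal ((Real.sqrt (t' - s))⁻¹) * _
          ≤ ENNReal.ofReal ((Real.sqrt (Real.pi * ν))⁻¹) * ENNReal.ofReal ((Real.sqrt (t' - s))⁻¹) *
              (K_F * Q ^ (1 / 2 : ℝ) * ∫⁻ x, ‖fderiv ℝ (u s) x‖ₑ ^ 2) := by gcongr
        _ = _ := by ring
    have hIW : (∫⁻ s in Ioo 0 t', ENNReal.ofReal ((Real.sqrt (t' - s))⁻¹) * ∫⁻ x, ‖fderiv ℝ (u s) x‖ₑ ^ 2) ≤ W :=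
      le_iSup₂_of_le (f := fun (t' : ℝ) (_ : t' ∈ Icc 0 t) =>
        ∫⁻ s in Ioo 0 t', ENNReal.ofReal ((Real.sqrt (t' - s))⁻¹) * ∫⁻ x, ‖fderiv ℝ (u s) x‖ₑ ^ 2) t' ht' le_rfl
    calc _ ≤ P₀ + 2 * ((K_F * Q ^ (1 / 2 : ℝ) * ENNReal.ofReal ((Real.sqrt (Real.pi * ν))⁻¹)) * W) := by
          gcongr
          exact hint.trans (mul_le_mul' le_rfl hIW)
      _ = P₀ + Q ^ (1 / 2 : ℝ) * (B * W) := by rw [hB]; ring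
  -- the quadratic closure
  have hQle : Q ≤ P₀ + Q ^ (1 / 2 : ℝ) * (B * W) :=
    iSup₂_le fun t' ht' => iSup_le fun R' => iSup_le fun c' => hmain t' ht' R' c'
  have hV := le_two_mul_add_sq_of_le_add_sqrt_mul hQt hQle
  have hBsq : (B * W) ^ 2 = 4 * K_F ^ 2 * ENNReal.ofReal ((Real.pi * ν)⁻¹) * W ^ 2 := by
    rw [hB, mul_pow, mul_pow, mul_pow, ← ENNReal.ofReal_pow (inv_nonneg.2 (Real.sqrt_nonneg _)), inv_pow,
      Real.sq_sqrt (by positivity)]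
    norm_num
  calc _ ≤ Q := hEQ t ⟨ht.1, le_rfl⟩ R c
    _ ≤ 2 * P₀ + (B * W) ^ 2 := hV
    _ = _ := by rw [hBsq]

/-- **THE DYNAMIC PLANAR CEILING** (registered closed form, sub-goal `dynamicPlanarCeiling` of
stmt-NavierStokesRegularity-16855; strategist census gen 1, A-S6 (F2), UNCONDITIONAL). There is a
universal `C ≥ 0` such that along every classical solution `(u,p)` of unforced Navier–Stokes on
`ℝ³ × [0,T)` (`ν > 0`) that is Leray–Hopf from a rapidly decaying datum, for every `t ∈ [0,T)`, every
linear isometry `R` and offset `c`: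
`∫_{ℝ²} ‖u(t, R(y₀,y₁,c))‖² dy ≤ 2 · sup_{R',c'} ∫_{ℝ²} ‖u(0, R'(y₀,y₁,c'))‖² dy + (C/ν) · W(t)²`,
`W(t) = sup_{t' ∈ [0,t]} ∫_{(0,t')} (t'−s)^{-1/2} (∫ ‖Du(s)‖²) ds` the running enstrophy
half-potential. Planar energy can exceed twice the initial planar ceiling only through the
time-averaged enstrophy `W`; with Leray's enstrophy lower bound at a blow-up time, `W` is finite up to
`T` exactly when the solution extends past `T` (census `HalfPotentialDivergesAtBlowup`), and under
Leray-rate enstrophy `‖∇u(s)‖₂² ≲ (T−s)^{-1/2}` the planar energies grow at most like `log²`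
(census `TypeIEnstrophyLogSqCeiling`). [folklore from the landed inputs; RRS2016 Lemma 5.1] -/
theorem dynamicPlanarCeiling : ∃ C : ℝ, 0 ≤ C ∧ ∀ (ν T : ℝ), 0 < ν → 0 < T → ∀ (u : ℝ → EuclideanSpace ℝ (Fin 3) → EuclideanSpace ℝ (Fin 3)) (p : ℝ → EuclideanSpace ℝ (Fin 3) → ℝ), Literature.Analysis.FluidPDE.IsClassicalNSSolutionOn (Set.Ico 0 T) ν 0 u p → Literature.Analysis.FluidPDE.IsLerayHopfOn T ν 0 (u 0) u → Literature.Analysis.FluidPDE.HasRapidSpatialDecay (u 0) → ∀ t ∈ Set.Ico 0 T, ∀ (R : EuclideanSpace ℝ (Fin 3) ≃ₗᵢ[ℝ] EuclideanSpace ℝ (Fin 3)) (c : ℝ), ∫⁻ y : EuclideanSpace ℝ (Fin 2), ‖u t (R (WithLp.toLp 2 ![y 0, y 1, c]))‖ₑ ^ 2 ≤ 2 * (⨆ (R' : EuclideanSpace ℝ (Fin 3) ≃ₗᵢ[ℝ] EuclideanSpace ℝ (Fin 3)) (c' : ℝ), ∫⁻ y : EuclideanSpace ℝ (Fin 2), ‖u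 0 (R' (WithLp.toLp 2 ![y 0, y 1, c']))‖ₑ ^ 2) + ENNReal.ofReal (C / ν) * (⨆ t' ∈ Set.Icc 0 t, ∫⁻ s in Set.Ioo 0 t', ENNReal.ofReal ((Real.sqrt (t' - s))⁻¹) * ∫⁻ x, ‖fderiv ℝ (u s) x‖ₑ ^ 2) ^ 2 := by
  obtain ⟨K_F, hKt, hK⟩ := fluxVariationBound
  set k : ℝ := K_F.toReal with hk
  have hk0 : 0 ≤ k := ENNReal.toReal_nonneg
  have hKe : K_F = ENNReal.ofReal k := (ENNReal.ofReal_toReal hKt).symm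
  refine ⟨4 * k ^ 2 / Real.pi, by positivity, fun ν T hν hT u p hcl hLH hdec t ht R c => ?_⟩
  have h := dynamicPlanarCeiling_of_fluxVariation hKt hK hν hT hcl hLH hdec ht R c
  have hC : 4 * K_F ^ 2 * ENNReal.ofReal ((Real.pi * ν)⁻¹) = ENNReal.ofReal (4 * k ^ 2 / Real.pi / ν) := by
    rw [hKe, ← ENNReal.ofReal_pow hk0, ← ENNReal.ofReal_ofNat, ← ENNReal.ofReal_mul (by norm_num),
      ← ENNReal.ofReal_mul (by positivity)]
    congr 1
    field_simp
  rwa [hC] at h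

/-! ### Glue: the crux from a half-potential bound, and from the flux-convergence budget -/

/-- **The crux BY NAME from a bound on the enstrophy half-potential** (the census's
`HalfPotentialEnstrophyBound` along every frame solution; glue `planarEnergyAPriori_of_dynamicCeiling`
with the dynamic ceiling and the initial ceiling now PROVED). The hypothesis is NoBlowup in other
clothes (Leray's enstrophy rate), so this is calibration, not a reduction. -/
theorem planarEnergyAPriori_of_halfPotentialBound
    (hW : ∀ (ν T : ℝ), 0 < ν → 0 < T →
      ∀ (u : ℝ → EuclideanSpace ℝ (Fin 3) → EuclideanSpace ℝ (Fin 3)) (p : ℝ → EuclideanSpace ℝ (Fin 3) → ℝ),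
      IsClassicalNSSolutionOn (Ico 0 T) ν 0 u p → IsLerayHopfOn T ν 0 (u 0) u → HasRapidSpatialDecay (u 0) →
      ∃ W₀ : ℝ, ∀ t ∈ Ico 0 T,
        (∫⁻ s in Ioo 0 t, ENNReal.ofReal ((Real.sqrt (t - s))⁻¹) * ∫⁻ x, ‖fderiv ℝ (u s) x‖ₑ ^ 2) ≤ ENNReal.ofReal W₀) :
    Summit.NavierStokesRegularity.NavierStokesRegularity.Theses.PlaneEnergyCeiling.PlanarEnergyAPriori := by
  obtain ⟨C, hC0, hC⟩ := dynamicPlanarCeiling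
  intro ν T hν hT u p hcl hLH hdec
  obtain ⟨M₀, hM₀, hinit⟩ := stub_initialPlanarCeiling (u 0) hdec
  obtain ⟨W₀, hW₀⟩ := hW ν T hν hT u p hcl hLH hdec
  refine ⟨2 * M₀ + C / ν * W₀ ^ 2, fun t ht R c => ?_⟩
  have h := hC ν T hν hT u p hcl hLH hdec t ht R c
  have hP0 : (⨆ (R' : EuclideanSpace ℝ (Fin 3) ≃ₗᵢ[ℝ] EuclideanSpace ℝ (Fin 3)) (c' : ℝ),
      ∫⁻ y : EuclideanSpace ℝ (Fin 2), ‖u 0 (R' (toLp 2 ![y 0, y 1, c']))‖ₑ ^ 2) ≤ ENNReal.ofReal M₀ :=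
    iSup₂_le fun R' c' => hinit R' c'
  have hWle : (⨆ t' ∈ Icc 0 t, ∫⁻ s in Ioo 0 t', ENNReal.ofReal ((Real.sqrt (t' - s))⁻¹) *
      ∫⁻ x, ‖fderiv ℝ (u s) x‖ₑ ^ 2) ≤ ENNReal.ofReal W₀ :=
    iSup₂_le fun t' ht' => hW₀ t' ⟨ht'.1, lt_of_le_of_lt ht'.2 ht.2⟩
  have hsq : (ENNReal.ofReal W₀) ^ 2 ≤ ENNReal.ofReal (W₀ ^ 2) := by
    rcases le_or_gt 0 W₀ with hw | hw
    · rw [ENNReal.ofReal_pow hw]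
    · rw [ENNReal.ofReal_of_nonpos hw.le]; simp
  have hCν : 0 ≤ C / ν := div_nonneg hC0 hν.le
  calc _ ≤ _ := h
    _ ≤ 2 * ENNReal.ofReal M₀ + ENNReal.ofReal (C / ν) * ENNReal.ofReal (W₀ ^ 2) := by
        gcongr
        exact (pow_le_pow_left' hWle 2).trans hsq
    _ = ENNReal.ofReal (2 * M₀ + C / ν * W₀ ^ 2) := by
        rw [ENNReal.ofReal_add (by positivity) (by positivity), ENNReal.ofReal_mul (by norm_num),
          ENNReal.ofReal_ofNat, ENNReal.ofReal_mul hCν]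

end Summit.NavierStokesRegularity.NavierStokesRegularity.Theorems.PlanarEnergyAPriori

end
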